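import Literature.MathematicalPhysics.QuantumLattice.GaugeGroups
import HarnessLib

/-!
# Narrow-well plaquette actions: the van Enter–Shlosman first-order transition, and their
# realisation as Wilson actions of tensor-power representations of `SU(2)`

van Enter–Shlosman [VanEnterShlosman2005] proved the first rigorous first-order transition for a
lattice gauge model with a CONTINUOUS gauge group: for the "narrow-well" single-plaquette action
`J · ((1 + L(U_P))/2)^p` (`L` the normalised real trace, `L = 1` exactly at `U_P = 1`; for `U(1)`,
eq. (3) of the paper, `((1 + cos φ_P)/2)^p`) in dimension `d ≥ 3` and for `p` large, the free
energy is not differentiable in the temperature at some point (reflection positivity and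
chessboard estimates, after Kotecký–Shlosman's large-entropy mechanism [KoteckyShlosman1982]).

This file records

* `NarrowWell.weight p` — the narrow-well density `g ↦ ((1 + ½ Re tr g)/2)^p` on `SU(2)`;
* `enterShlosman_narrowWell_firstOrderTransition` — Theorem 2 of the paper, `SU(2)` instance, as
  a NAMED FACT (not proved here): for `d ≥ 3` and `p ≥ p₀(d)`, any function `P` that is the
  thermodynamic limit of the torus pressures `(L+1)^{-d} log ∫ ∏_q exp(J · weight p (U_q)) dU`
  for every real `J` fails to be differentiable at some `J_t > 0` (the limit exists by
  `tendsto_torusPressure_of_continuous_pos` of `PlaquetteWeightFreeEnergyLimit`, not imported);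
* (`NarrowWell.kpow`, `NarrowWell.blockRep`, `NarrowWell.rep`, `NarrowWell.trace_re_rep`) the
  folklore observation that this action IS a Wilson action `β Re tr ρ(U_P)` for a genuine
  faithful continuous unitary matrix representation of `SU(2)`: with `W = ℂ² ⊕ ℂ ⊕ ℂ`
  (fundamental plus two trivial summands, `tr_W g = 2 + tr g = 4 · (1 + ½ Re tr g)/2`) and
  `ρ_p = W^{⊗(p+1)}` realised by Kronecker powers in function-index form
  (`kpow p M i j = ∏ k, M (i k) (j k)`), one has `Re tr ρ_p(g) = 4^{p+1} · weight (p+1) g`.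
  Consequently Wilson's action in the representation `ρ_p` of `SU(2)` has a first-order bulk
  transition (modulo the named fact): analyticity of the Wilson pressure on the whole coupling
  axis fails for SOME faithful representation already of `SU(2)`.

Design: the representation is a `MonoidHom` into `Matrix (Fin N) (Fin N) ℂ` (reindexed along
`Fintype.equivFin`) so that it can be packaged downstream as lattice-representation data; no
`LatticeRep` structure is imported here (it lives in `QuantumFieldTheory/YangMillsOS`).  What is
NOT here: the proof of Theorem 2 (contour/chessboard estimates), the `U(1)` and `RP^{N-1}`
statements of the paper (Theorem 1), general compact gauge groups.

References: A. C. D. van Enter, S. B. Shlosman, *Provable first-order transitions for nonlinear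
vector and gauge models with continuous symmetries*, Commun. Math. Phys. 255 (2005) 21–32,
Theorem 2 and eq. (3) [VanEnterShlosman2005]; R. Kotecký, S. B. Shlosman, Commun. Math. Phys. 83
(1982) 493–515 [KoteckyShlosman1982].
-/

noncomputable section

open _root_.MeasureTheory _root_.Filter
open scoped BigOperators

namespace Literature.MathematicalPhysics.QuantumLattice

open Literature.MathematicalPhysics.QuantumFieldTheory

namespace NarrowWell

/-! ### The narrow-well density -/

/-- The **narrow-well plaquette density** of van Enter–Shlosman on `SU(2)`:
`weight p g = ((1 + ½ Re tr g)/2)^p ∈ [0, 1]`, equal to `1` exactly at `g = 1` and sharply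
peaked there for large `p` (the paper's `((1 + L(U))/2)^p` with the normalised trace
`L = ½ Re tr`, cf. eq. (3) for `U(1)`). [cite: VanEnterShlosman2005, eq. (3) and Thm. 2] -/
def weight (p : ℕ) (g : Matrix.specialUnitaryGroup (Fin 2) ℂ) : ℝ :=
  ((1 + (g : Matrix (Fin 2) (Fin 2) ℂ).trace.re / 2) / 2) ^ p

/-- The narrow-well density is continuous. [folklore] -/
theorem continuous_weight (p : ℕ) : Continuous (weight p) :=
  ((continuous_const.add ((Complex.continuous_re.comp
    (continuous_subtype_val.matrix_trace)).div_const _)).div_const _).pow _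

/-! ### Kronecker (tensor) powers of a square matrix in function-index form -/

/-- The `p`-fold Kronecker (tensor) power of a square complex matrix, indexed by functions
`Fin p → n`: `kpow p M i j = ∏ k, M (i k) (j k)` (the matrix of `M^{⊗p}` on `(ℂⁿ)^{⊗p}` in the
product basis). [folklore] -/
def kpow {n : Type} (p : ℕ) (M : Matrix n n ℂ) : Matrix (Fin p → n) (Fin p → n) ℂ :=
  fun i j => ∏ k, M (i k) (j k)

/-- Tensor powers are multiplicative: `(MN)^{⊗p} = M^{⊗p} N^{⊗p}` (sum over functions of a
product is the product of sums). [folklore] -/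
theorem kpow_mul {n : Type} [Fintype n] (p : ℕ) (M N : Matrix n n ℂ) :
    kpow p (M * N) = kpow p M * kpow p N := by
  ext i j
  simp only [kpow, Matrix.mul_apply]
  rw [Finset.prod_univ_sum]
  simp only [Fintype.piFinset_univ]
  refine Finset.sum_congr rfl fun m _ => ?_
  rw [← Finset.prod_mul_distrib]

/-- `1^{⊗p} = 1`. [folklore] -/
theorem kpow_one {n : Type} [DecidableEq n] (p : ℕ) : kpow p (1 : Matrix n n ℂ) = 1 := by
  ext i j
  simp only [kpow, Matrix.one_apply]
  by_cases h : i = j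
  · subst h
    simp
  · rw [if_neg h]
    obtain ⟨k, hk⟩ := Function.ne_iff.mp h
    exact Finset.prod_eq_zero (Finset.mem_univ k) (if_neg hk)

/-- Tensor powers commute with the conjugate transpose. [folklore] -/
theorem kpow_conjTranspose {n : Type} (p : ℕ) (M : Matrix n n ℂ) :
    kpow p M.conjTranspose = (kpow p M).conjTranspose := by
  ext i j
  simp only [kpow, Matrix.conjTranspose_apply, star_prod]

/-- `tr (M^{⊗p}) = (tr M)^p`. [folklore] -/
theorem trace_kpow {n : Type} [Fintype n] (p : ℕ) (M : Matrix n n ℂ) :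
    (kpow p M).trace = M.trace ^ p := by
  simp only [Matrix.trace, Matrix.diag, kpow]
  rw [← Fin.prod_const, Finset.prod_univ_sum]
  simp only [Fintype.piFinset_univ]

/-- Tensor powers of a unitary matrix are unitary. [folklore] -/
theorem kpow_mem_unitaryGroup {n : Type} [Fintype n] [DecidableEq n] (p : ℕ) {M : Matrix n n ℂ}
    (hM : M ∈ Matrix.unitaryGroup n ℂ) : kpow p M ∈ Matrix.unitaryGroup (Fin p → n) ℂ := by
  rw [Matrix.mem_unitaryGroup_iff] at hM ⊢
  rw [Matrix.star_eq_conjTranspose, ← kpow_conjTranspose, ← kpow_mul,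
    ← Matrix.star_eq_conjTranspose, hM, kpow_one]

/-- The entry of `M^{⊗(p+1)}` at indices that differ from a base point `b` with `M b b = 1`
only in slot `0` is the corresponding entry of `M`. [folklore] -/
theorem kpow_update {n : Type} (p : ℕ) (M : Matrix n n ℂ) (b : n) (hb : M b b = 1) (x y : n) :
    kpow (p + 1) M (Function.update (fun _ => b) 0 x) (Function.update (fun _ => b) 0 y) =
      M x y := by
  simp only [kpow]
  rw [Fin.prod_univ_succ]
  simp only [Function.update_self]
  have h : ∀ k : Fin p, Function.update (fun _ : Fin (p + 1) => b) 0 x k.succ = b := fun k => by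
    rw [Function.update_of_ne (Fin.succ_ne_zero k)]
  have h' : ∀ k : Fin p, Function.update (fun _ : Fin (p + 1) => b) 0 y k.succ = b := fun k => by
    rw [Function.update_of_ne (Fin.succ_ne_zero k)]
  simp only [h, h', hb, Finset.prod_const_one, mul_one]

/-- `M ↦ M^{⊗p}` is continuous (entries are finite products of entries). [folklore] -/
theorem continuous_kpow {n : Type} [Fintype n] (p : ℕ) : Continuous (kpow (n := n) p) :=
  continuous_pi fun i => continuous_pi fun j =>
    continuous_finsetProd _ fun k _ => (continuous_apply (j k)).comp (continuous_apply (i k))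

/-! ### The representation `W = ℂ² ⊕ ℂ ⊕ ℂ` of `SU(2)` and its tensor powers -/

/-- The block-diagonal representation `g ↦ diag(g, 1₂)` of `SU(2)` on `W = ℂ² ⊕ ℂ²`
(fundamental plus two trivial summands). [folklore] -/
def blockRep :
    Matrix.specialUnitaryGroup (Fin 2) ℂ →* Matrix (Fin 2 ⊕ Fin 2) (Fin 2 ⊕ Fin 2) ℂ where
  toFun g := Matrix.fromBlocks (g : Matrix (Fin 2) (Fin 2) ℂ) 0 0 1
  map_one' := by simp [Matrix.fromBlocks_one]
  map_mul' g h := by simp [Matrix.fromBlocks_multiply]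

/-- Unfolding `blockRep`. [folklore] -/
theorem blockRep_apply (g : Matrix.specialUnitaryGroup (Fin 2) ℂ) :
    blockRep g = Matrix.fromBlocks (g : Matrix (Fin 2) (Fin 2) ℂ) 0 0 1 := rfl

/-- `blockRep` is continuous. [folklore] -/
theorem continuous_blockRep : Continuous blockRep := by
  refine continuous_matrix fun i j => ?_
  rcases i with i | i <;> rcases j with j | j
  · simp only [blockRep_apply, Matrix.fromBlocks_apply₁₁]
    exact (continuous_apply j).comp ((continuous_apply i).comp continuous_subtype_val)
  · simp only [blockRep_apply, Matrix.fromBlocks_apply₁₂]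
    exact continuous_const
  · simp only [blockRep_apply, Matrix.fromBlocks_apply₂₁]
    exact continuous_const
  · simp only [blockRep_apply, Matrix.fromBlocks_apply₂₂]
    exact continuous_const

/-- `blockRep` is unitary. [folklore] -/
theorem blockRep_mem_unitaryGroup (g : Matrix.specialUnitaryGroup (Fin 2) ℂ) :
    blockRep g ∈ Matrix.unitaryGroup (Fin 2 ⊕ Fin 2) ℂ := by
  rw [Matrix.mem_unitaryGroup_iff, blockRep_apply, Matrix.star_eq_conjTranspose,
    Matrix.fromBlocks_conjTranspose, Matrix.fromBlocks_multiply]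
  have hg : (g : Matrix (Fin 2) (Fin 2) ℂ) * (g : Matrix (Fin 2) (Fin 2) ℂ).conjTranspose = 1 := by
    have := Matrix.mem_unitaryGroup_iff.mp (Matrix.specialUnitaryGroup_le_unitaryGroup g.2)
    simpa [Matrix.star_eq_conjTranspose] using this
  simp [hg, Matrix.fromBlocks_one]

/-- `tr_W g = 2 + tr g`. [folklore] -/
theorem trace_blockRep (g : Matrix.specialUnitaryGroup (Fin 2) ℂ) :
    (blockRep g).trace = 2 + (g : Matrix (Fin 2) (Fin 2) ℂ).trace := by
  rw [blockRep_apply, Matrix.trace, Matrix.trace]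
  simp only [Matrix.diag, Fintype.sum_sum_type, Matrix.fromBlocks_apply₁₁,
    Matrix.fromBlocks_apply₂₂, Matrix.one_apply_eq, Finset.sum_const, Finset.card_univ,
    Fintype.card_fin]
  norm_num [add_comm]

/-- The trivial block of `blockRep` has unit diagonal. [folklore] -/
theorem blockRep_inr_inr (g : Matrix.specialUnitaryGroup (Fin 2) ℂ) (a : Fin 2) :
    blockRep g (Sum.inr a) (Sum.inr a) = 1 := by
  simp [blockRep_apply]

/-- `blockRep` is faithful. [folklore] -/
theorem blockRep_injective : Function.Injective blockRep := by
  intro g h hgh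
  apply Subtype.ext
  ext i j
  have := congrFun (congrFun hgh (Sum.inl i)) (Sum.inl j)
  simpa [blockRep_apply] using this

/-- Index type of the `(p+1)`-st tensor power of `W = ℂ² ⊕ ℂ²` (product basis). [folklore] -/
abbrev Index (p : ℕ) : Type := Fin (p + 1) → (Fin 2 ⊕ Fin 2)

/-- **The van Enter–Shlosman representation** `ρ_p = W^{⊗(p+1)}` of `SU(2)`, `W = ℂ² ⊕ ℂ ⊕ ℂ`,
as a monoid homomorphism into `4^{p+1} × 4^{p+1}` complex matrices (Kronecker power of
`blockRep`, reindexed along `Fintype.equivFin`). [folklore] -/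
def rep (p : ℕ) : Matrix.specialUnitaryGroup (Fin 2) ℂ →*
    Matrix (Fin (Fintype.card (Index p))) (Fin (Fintype.card (Index p))) ℂ where
  toFun g := Matrix.reindex (Fintype.equivFin (Index p)) (Fintype.equivFin (Index p))
    (kpow (p + 1) (blockRep g))
  map_one' := by
    rw [map_one, kpow_one]
    exact Matrix.submatrix_one_equiv _
  map_mul' g h := by
    rw [map_mul, kpow_mul]
    exact (Matrix.submatrix_mul_equiv _ _ _ _ _).symm

/-- Unfolding `rep`. [folklore] -/
theorem rep_apply (p : ℕ) (g : Matrix.specialUnitaryGroup (Fin 2) ℂ) :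
    rep p g = Matrix.reindex (Fintype.equivFin (Index p)) (Fintype.equivFin (Index p))
      (kpow (p + 1) (blockRep g)) := rfl

/-- `ρ_p` is continuous. [folklore] -/
theorem continuous_rep (p : ℕ) : Continuous (rep p) := by
  refine continuous_matrix fun i j => ?_
  simp only [rep_apply, Matrix.reindex_apply, Matrix.submatrix_apply]
  exact ((continuous_apply _).comp ((continuous_apply _).comp
    ((continuous_kpow (p + 1)).comp continuous_blockRep)))

/-- `ρ_p` is faithful (read off the entries concentrated in one tensor slot over the trivial
block). [folklore] -/
theorem rep_injective (p : ℕ) : Function.Injective (rep p) := by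
  intro g h hgh
  apply blockRep_injective
  ext x y
  have key : kpow (p + 1) (blockRep g) = kpow (p + 1) (blockRep h) := by
    have := congrArg (Matrix.reindex (Fintype.equivFin (Index p)).symm
      (Fintype.equivFin (Index p)).symm) hgh
    simpa [rep_apply] using this
  have := congrFun (congrFun key (Function.update (fun _ => Sum.inr 0) 0 x))
    (Function.update (fun _ => Sum.inr 0) 0 y)
  rwa [kpow_update _ _ _ (blockRep_inr_inr g 0), kpow_update _ _ _ (blockRep_inr_inr h 0)] at this

/-- `ρ_p` is unitary. [folklore] -/
theorem rep_mem_unitaryGroup (p : ℕ) (g : Matrix.specialUnitaryGroup (Fin 2) ℂ) :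
    rep p g ∈ Matrix.unitaryGroup (Fin (Fintype.card (Index p))) ℂ := by
  have hk := kpow_mem_unitaryGroup (p + 1) (blockRep_mem_unitaryGroup g)
  rw [Matrix.mem_unitaryGroup_iff] at hk ⊢
  rw [rep_apply, Matrix.reindex_apply, Matrix.star_eq_conjTranspose,
    Matrix.conjTranspose_submatrix, ← Matrix.star_eq_conjTranspose,
    Matrix.submatrix_mul_equiv, hk]
  exact Matrix.submatrix_one_equiv _

/-- `tr ρ_p(g) = (2 + tr g)^{p+1}`. [folklore] -/
theorem trace_rep (p : ℕ) (g : Matrix.specialUnitaryGroup (Fin 2) ℂ) :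
    (rep p g).trace = (2 + (g : Matrix (Fin 2) (Fin 2) ℂ).trace) ^ (p + 1) := by
  rw [rep_apply]
  have : (Matrix.reindex (Fintype.equivFin (Index p)) (Fintype.equivFin (Index p))
      (kpow (p + 1) (blockRep g))).trace = (kpow (p + 1) (blockRep g)).trace := by
    simp only [Matrix.trace, Matrix.diag_apply, Matrix.reindex_apply, Matrix.submatrix_apply]
    exact (Fintype.equivFin (Index p)).symm.sum_comp (fun i => kpow (p + 1) (blockRep g) i i)
  rw [this, trace_kpow, trace_blockRep]

/-- The trace of an `SU(2)` matrix is real (`g⁻¹ = gᴴ = adj g` for `det g = 1`, so the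
diagonal entries are complex conjugate). [folklore] -/
theorem trace_im_eq_zero (g : Matrix.specialUnitaryGroup (Fin 2) ℂ) :
    ((g : Matrix (Fin 2) (Fin 2) ℂ).trace).im = 0 := by
  obtain ⟨hU, hdet⟩ := Matrix.mem_specialUnitaryGroup_iff.mp g.2
  set A : Matrix (Fin 2) (Fin 2) ℂ := (g : Matrix (Fin 2) (Fin 2) ℂ)
  have h1 : star A * A = 1 := Matrix.mem_unitaryGroup_iff'.mp hU
  have h2 : A.adjugate * A = 1 := by
    rw [Matrix.adjugate_mul, hdet, one_smul]
  have h3 : star A = A.adjugate := by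
    rw [← Matrix.inv_eq_left_inv h1, Matrix.inv_eq_left_inv h2]
  have h4 : star (A 0 0) = A 1 1 := by
    have := congrFun (congrFun h3 0) 0
    rw [Matrix.adjugate_fin_two] at this
    simpa [Matrix.star_apply] using this
  rw [Matrix.trace_fin_two, ← h4, Complex.star_def, Complex.add_im, Complex.conj_im]
  ring

/-- **The narrow-well action is a Wilson action**: `Re tr ρ_p(g) = 4^{p+1} · weight (p+1) g`,
i.e. `J · ((1 + ½ Re tr U)/2)^{p+1} = β Re tr ρ_p(U)` with `J = 4^{p+1} β`. [folklore] -/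
theorem trace_re_rep (p : ℕ) (g : Matrix.specialUnitaryGroup (Fin 2) ℂ) :
    ((rep p g).trace).re = (4 : ℝ) ^ (p + 1) * weight (p + 1) g := by
  rw [trace_rep, weight]
  have hreal : (2 + (g : Matrix (Fin 2) (Fin 2) ℂ).trace) =
      ((2 + (g : Matrix (Fin 2) (Fin 2) ℂ).trace.re : ℝ) : ℂ) := by
    apply Complex.ext
    · simp
    · simp [trace_im_eq_zero g]
  rw [hreal, ← Complex.ofReal_pow, Complex.ofReal_re, ← mul_pow]
  congr 1
  ring

end NarrowWell

/-! ### The named fact: van Enter–Shlosman's first-order transition (Theorem 2), `SU(2)` instance -/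

/-- **van Enter–Shlosman (2005), Theorem 2 — first-order transition of narrow-well lattice gauge
models; `SU(2)` instance (NAMED FACT, not proved here).**  As printed: "For lattice gauge models
with plaquette action `((1 + L(U_P))/2)^p`, (where `L(U_P) = Tr(U_P + U_P*)`) in dimension 3 and
more and `p` high enough, there is a first order transition, that is there exists a temperature
at which the free energy is not differentiable in the temperature parameter."  The variables are
"elements of a unitary representation of a compact continuous gauge group, e.g. `U(1)`, `SU(n)`";
the normalisation is that of eq. (3) (`L ∈ [-1, 1]`, `L = 1` exactly at `U_P = 1`; for `SU(2)`:
`L = ½ Re tr`, density `NarrowWell.weight p`).  Rendering: for every `d ≥ 3` there is `p₀` such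
that for all `p ≥ p₀`, every function `P : ℝ → ℝ` which is, for EVERY real coupling `J`, the
limit of the torus pressures `(L+1)^{-d} log ∫ ∏_q exp(J · weight p (U_q)) ∏_e dU_e` of the
discrete tori `(ℤ/(L+1)ℤ)^d` (Haar product measure; such `P` exists and is unique, by the
general-weight thermodynamic limit `tendsto_torusPressure_of_continuous_pos`) is NOT
differentiable at some coupling `J_t > 0` (inverse temperature; the pressure and the free energy
`-T P(1/T)` are non-differentiable at the same points).
-- TODO(general form): any compact gauge group in a unitary representation, `L = Re tr / N`;
-- Theorem 1 (`RP^{N-1}` models, `d ≥ 2`).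
[cite: VanEnterShlosman2005, Thm. 2 (with the normalisation of eq. (3))] -/
def enterShlosman_narrowWell_firstOrderTransition : Prop :=
  ∀ d : ℕ, 3 ≤ d → ∃ p₀ : ℕ, ∀ p : ℕ, p₀ ≤ p → ∀ P : ℝ → ℝ,
    (∀ J : ℝ, Tendsto (fun L : ℕ => (((L + 1 : ℕ) : ℝ) ^ d)⁻¹ *
      Real.log (∫ U : GaugeConfig d (L + 1) (Matrix.specialUnitaryGroup (Fin 2) ℂ),
        ∏ q : Plaquette d (L + 1),
          Real.exp (J * NarrowWell.weight p (plaquetteHolonomy U q.1 q.2.1.1 q.2.1.2))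
        ∂(Measure.pi fun _ : Edge d (L + 1) =>
          haarProbability (Matrix.specialUnitaryGroup (Fin 2) ℂ))))
      atTop (nhds (P J))) →
    ∃ Jt : ℝ, 0 < Jt ∧ ¬ DifferentiableAt ℝ P Jt

end Literature.MathematicalPhysics.QuantumLattice

end
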